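import Summits.BirchSwinnertonDyer.BirchSwinnertonDyer.Theorems.BiquadraticEisensteinDescentHeegnerTwistCouplingInSupplySymbolicMonskyClosure
import Summits.BirchSwinnertonDyer.BirchSwinnertonDyer.Theorems.BiquadraticEisensteinDescentHeegnerTwistCouplingInSupplySymbolicMonskyPatternFreeDoor
import HarnessLib

set_option linter.dupNamespace false -- `Summit.BirchSwinnertonDyer.BirchSwinnertonDyer.Theorems.…` (summit = sub)
set_option autoImplicit false

/-!
# Crux `HeegnerTwistCouplingInSupply` (stmt-BirchSwinnertonDyer-21381) — the MULTI-STAGE (closure) pattern-free criterion, part 2: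
# direction-wise agreement of the symbolic Monsky matrices, the ★ closure theorems, general-`k` recipes, the doors, and the
# `k = 3` aligned exceptional class certified by ONE check

Route `BiquadraticEisensteinDescent` (cell `pub/bsd-wall`, width seat `bsd-wall-cm-bed-w3` g21; `--supports` 21381, helper). Proof file
(2/2) of the closure layer (`…SymbolicMonskyClosureDefs` p726614, part 1 `…SymbolicMonskyClosure`).

* `AgreeOffAux.drow_monskyOddS_eq` / `…EvenS…` — (ii-δ): for symbol data agreeing off `Q × Q`, if `z` is `Q`-constant in direction
  `δ ∈ {u, v, w}` then the direction-`δ` rows (half one / half two / row sums) of `M(d') z` and `M(d) z` agree (row structure of w3 g20's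
  `monskyOddS_mulVec_inl/inr`; for `w` the two symbol sums combine into one against the sum vector).
* ★ `SymbData.det_monskyOddS_eq_one_of_pfClosureCheckOdd` / `…Even…`: `d.pfClosureCheckOdd Q = true → d.AgreeOffAux Q d' → det M_odd(d') = 1`.
* ★ `det_dataK_odd_of_pfClosureRecipeOdd` / `…even…` (general `k`): a recipe passing `pfClosureRecipeOdd base aux` has the Heegner check and
  `det M_odd(dataK base aux pat) = 1` for EVERY mutual pattern; `forall_det_odd_of_pfRecipeOdd` / `…_of_pfClosureRecipeOdd` put the
  one-stage (p722162) and the closure checks on the same footing («every-pattern conclusion»).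
* THE DOORS from the every-pattern conclusion (`RealisesK.cruxOn_odd/even_of_BT_of_forall`, copies of w3 g20's `cruxOn_odd/even_of_BT` with
  the weaker hypothesis) and for closure recipes (`RealisesK.cruxOn_odd/even_of_BT_closure`): realised primes + the size bound give the
  conclusion of crux 21381 for `W = E_{P₀⋯P_k}` / `E_{2P₀⋯P_k}`, modulo Burungale–Tian ONLY.
* EXAMPLES `closure_example_X0` / `closure_example_X1` / `det_X0_all_patterns`: the two aligned exceptional configurations at `k = 3`
  (`p ≡ 3 (8)`, `r ≡ (5,5,5) (8)`, all symbols `+1` resp. all `−1`; w3 g19's `t = 4` family `q₁ ≡ 7` non-residue at all four base primes,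
  `q₂, q₃, q₄ ≡ 1` non-residue at exactly one `r_i`) PASS the closure check and FAIL the one-stage check (`decide`), so `det = 1` for all
  `2^6` mutual patterns by ONE check — previously certifiable only pattern by pattern.

HONEST FRAMING: engine theorems; RUNG-LEVEL corner layer (congruent `j = 1728` families); which configurations own a closure recipe and
with how many auxiliary primes is the subject of the w3 g21 memo (lower bound `t ≥ max(t₀, κ_u+1, κ_w+1, κ_v+1)`; data `k ≤ 5`). The crux
as stated (C⁺), its registered stubs and BSD are NOT touched; nothing is closed. THEOREMS ONLY.
References: [HeathBrown1994] appendix (Monsky), typescript pp. 39–41; [BurungaleTian2026] Thm. 1.1; [Oesterle1988Gauss] II §3.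
-/

namespace Summit.BirchSwinnertonDyer.BirchSwinnertonDyer.Theorems.SymbolicMonsky

namespace SymbData

open Matrix

variable {k : ℕ} {d d' : SymbData k} {Q : Fin k → Bool}

/-- Sum of the two rows of index `i` of the symbol part, in difference form with the SUM vector `z_(inl ·) + z_(inr ·)`. -/
theorem sum_neg_mul_add_sum_neg_mul (e : SymbData k) (i : Fin k) (z : Fin k ⊕ Fin k → ZMod 2) :
    (∑ j : Fin k, bz (e.neg i j) * (z (Sum.inl j) + z (Sum.inl i))) +
      (∑ j : Fin k, bz (e.neg i j) * (z (Sum.inr j) + z (Sum.inr i))) =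
    ∑ j : Fin k, bz (e.neg i j) * ((z (Sum.inl j) + z (Sum.inr j)) + (z (Sum.inl i) + z (Sum.inr i))) := by
  rw [← Finset.sum_add_distrib]
  exact Finset.sum_congr rfl fun j _ => by ring

/-- **(ii-δ) odd**: if `z` is `Q`-constant in direction `δ` (`u`: `z_(inl ·)`, `v`: `z_(inr ·)`, `w`: their sum), the direction-`δ` rows
(`u`: half one, `v`: half two, `w`: row sums) of `M_odd(d') z` and `M_odd(d) z` agree at EVERY index. -/
theorem AgreeOffAux.drow_monskyOddS_eq (h : d.AgreeOffAux Q d') (z : Fin k ⊕ Fin k → ZMod 2) (δ : ℕ)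
    (hz : ∀ i j, Q i = true → Q j = true →
      (if δ = 0 then z (Sum.inl i) else if δ = 1 then z (Sum.inr i) else z (Sum.inl i) + z (Sum.inr i)) =
      (if δ = 0 then z (Sum.inl j) else if δ = 1 then z (Sum.inr j) else z (Sum.inl j) + z (Sum.inr j)))
    (i : Fin k) :
    (if δ = 0 then (d'.monskyOddS *ᵥ z) (Sum.inl i) else if δ = 1 then (d'.monskyOddS *ᵥ z) (Sum.inr i)
      else (d'.monskyOddS *ᵥ z) (Sum.inl i) + (d'.monskyOddS *ᵥ z) (Sum.inr i)) =
    (if δ = 0 then (d.monskyOddS *ᵥ z) (Sum.inl i) else if δ = 1 then (d.monskyOddS *ᵥ z) (Sum.inr i)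
      else (d.monskyOddS *ᵥ z) (Sum.inl i) + (d.monskyOddS *ᵥ z) (Sum.inr i)) := by
  have hc : ∀ j, d'.cls j = d.cls j := h.cls_eq
  by_cases h0 : δ = 0
  · subst h0
    simp only [if_true] at hz ⊢
    rw [d'.monskyOddS_mulVec_inl, d.monskyOddS_mulVec_inl, hc, h.sum_neg_mul_eq_of_const i (fun j => z (Sum.inl j)) hz]
  by_cases h1 : δ = 1
  · subst h1
    simp only [one_ne_zero, if_false, if_true] at hz ⊢
    rw [d'.monskyOddS_mulVec_inr, d.monskyOddS_mulVec_inr, hc, h.sum_neg_mul_eq_of_const i (fun j => z (Sum.inr j)) hz]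
  simp only [h0, h1, if_false] at hz ⊢
  rw [d'.monskyOddS_mulVec_inl, d'.monskyOddS_mulVec_inr, d.monskyOddS_mulVec_inl, d.monskyOddS_mulVec_inr, hc]
  have e' := sum_neg_mul_add_sum_neg_mul d' i z
  have e := sum_neg_mul_add_sum_neg_mul d i z
  have hs := h.sum_neg_mul_eq_of_const i (fun j => z (Sum.inl j) + z (Sum.inr j)) hz
  linear_combination e' - e + hs

/-- **(ii-δ) even** (same statement for `M_even`; the transposed reciprocity term of half one is pattern-independent). -/
theorem AgreeOffAux.drow_monskyEvenS_eq (h : d.AgreeOffAux Q d') (z : Fin k ⊕ Fin k → ZMod 2) (δ : ℕ)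
    (hz : ∀ i j, Q i = true → Q j = true →
      (if δ = 0 then z (Sum.inl i) else if δ = 1 then z (Sum.inr i) else z (Sum.inl i) + z (Sum.inr i)) =
      (if δ = 0 then z (Sum.inl j) else if δ = 1 then z (Sum.inr j) else z (Sum.inl j) + z (Sum.inr j)))
    (i : Fin k) :
    (if δ = 0 then (d'.monskyEvenS *ᵥ z) (Sum.inl i) else if δ = 1 then (d'.monskyEvenS *ᵥ z) (Sum.inr i)
      else (d'.monskyEvenS *ᵥ z) (Sum.inl i) + (d'.monskyEvenS *ᵥ z) (Sum.inr i)) =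
    (if δ = 0 then (d.monskyEvenS *ᵥ z) (Sum.inl i) else if δ = 1 then (d.monskyEvenS *ᵥ z) (Sum.inr i)
      else (d.monskyEvenS *ᵥ z) (Sum.inl i) + (d.monskyEvenS *ᵥ z) (Sum.inr i)) := by
  have hc : ∀ j, d'.cls j = d.cls j := h.cls_eq
  by_cases h0 : δ = 0
  · subst h0
    simp only [if_true] at hz ⊢
    rw [d'.monskyEvenS_mulVec_inl, d.monskyEvenS_mulVec_inl, Finset.sum_add_distrib, Finset.sum_add_distrib,
      h.sum_neg_mul_eq_of_const i (fun j => z (Sum.inl j)) hz]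
    simp only [hc]
  by_cases h1 : δ = 1
  · subst h1
    simp only [one_ne_zero, if_false, if_true] at hz ⊢
    rw [d'.monskyEvenS_mulVec_inr, d.monskyEvenS_mulVec_inr, hc, h.sum_neg_mul_eq_of_const i (fun j => z (Sum.inr j)) hz]
  simp only [h0, h1, if_false] at hz ⊢
  rw [d'.monskyEvenS_mulVec_inl, d'.monskyEvenS_mulVec_inr, d.monskyEvenS_mulVec_inl, d.monskyEvenS_mulVec_inr,
    Finset.sum_add_distrib, Finset.sum_add_distrib]
  simp only [hc]
  have e' := sum_neg_mul_add_sum_neg_mul d' i z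
  have e := sum_neg_mul_add_sum_neg_mul d i z
  have hs := h.sum_neg_mul_eq_of_const i (fun j => z (Sum.inl j) + z (Sum.inr j)) hz
  linear_combination e' - e + hs

/-! ## The ★ closure theorems -/

/-- ★ **CLOSURE PATTERN-FREE CRITERION, odd matrix.** If `d.pfClosureCheckOdd Q` accepts, then EVERY symbol datum `d'` agreeing with
`d` off `Q × Q` — arbitrary mutual symbols among the auxiliary primes — has `det M_odd(d') = 1` (`s = 0`). Strictly more general than
the one-stage `pfCheckOdd` (it accepts the aligned exceptional families, see the examples below).
[cite: HeathBrown1994SelmerCongruentII, Appendix (Monsky), typescript p. 39 L27–L33] -/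
theorem det_monskyOddS_eq_one_of_pfClosureCheckOdd (hpf : d.pfClosureCheckOdd Q = true) (h : d.AgreeOffAux Q d') :
    d'.monskyOddS.det = 1 := by
  simp only [SymbData.pfClosureCheckOdd, Bool.and_eq_true] at hpf
  obtain ⟨hdet, hcl⟩ := hpf
  exact det_eq_one_of_closureCheckRows Q d.monskyOddS d'.monskyOddS d.rowsOdd d.rowsOdd_length d.matOfRows_rowsOdd
    (fun z i hi => h.monskyOddS_mulVec_eq_of_not_mem z i hi) (fun z δ hz i _ => h.drow_monskyOddS_eq z δ hz i)
    (fun z hz => h.monskyOddS_mulVec_eq_of_const z hz) (fun z => h.sum_monskyOddS_mulVec_eq z)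
    (d.det_monskyOddS_eq_one hdet) hcl

/-- ★ **CLOSURE PATTERN-FREE CRITERION, even matrix.**
[cite: HeathBrown1994SelmerCongruentII, Appendix (Monsky), typescript p. 41 L20–L36] -/
theorem det_monskyEvenS_eq_one_of_pfClosureCheckEven (hpf : d.pfClosureCheckEven Q = true) (h : d.AgreeOffAux Q d') :
    d'.monskyEvenS.det = 1 := by
  simp only [SymbData.pfClosureCheckEven, Bool.and_eq_true] at hpf
  obtain ⟨hdet, hcl⟩ := hpf
  exact det_eq_one_of_closureCheckRows Q d.monskyEvenS d'.monskyEvenS d.rowsEven d.rowsEven_length d.matOfRows_rowsEven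
    (fun z i hi => h.monskyEvenS_mulVec_eq_of_not_mem z i hi) (fun z δ hz i _ => h.drow_monskyEvenS_eq z δ hz i)
    (fun z hz => h.monskyEvenS_mulVec_eq_of_const z hz) (fun z => h.sum_monskyEvenS_mulVec_eq z)
    (d.det_monskyEvenS_eq_one hdet) hcl

end SymbData

/-! ## General `k`: closure recipes win for every mutual pattern -/

section GeneralKClosure

variable {k : ℕ} (base : SymbData (k + 1)) (aux : List AuxCell)

/-- ★ **General-`k` closure recipe, odd base**: if `pfClosureRecipeOdd base aux` accepts, the Heegner check holds and `det M_odd = 1`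
for EVERY mutual pattern of the auxiliary primes. -/
theorem det_dataK_odd_of_pfClosureRecipeOdd (h : pfClosureRecipeOdd base aux = true) (pat : ℕ → ℕ → Bool) :
    heegnerK base aux = true ∧ (dataK base aux pat).monskyOddS.det = 1 := by
  simp only [pfClosureRecipeOdd, Bool.and_eq_true] at h
  exact ⟨h.1, SymbData.det_monskyOddS_eq_one_of_pfClosureCheckOdd h.2 (agreeOffAux_dataK base aux _ pat)⟩

/-- ★ **General-`k` closure recipe, even base**. -/
theorem det_dataK_even_of_pfClosureRecipeEven (h : pfClosureRecipeEven base aux = true) (pat : ℕ → ℕ → Bool) :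
    heegnerK base aux = true ∧ (dataK base aux pat).monskyEvenS.det = 1 := by
  simp only [pfClosureRecipeEven, Bool.and_eq_true] at h
  exact ⟨h.1, SymbData.det_monskyEvenS_eq_one_of_pfClosureCheckEven h.2 (agreeOffAux_dataK base aux _ pat)⟩

/-- The one-stage recipe check implies the every-pattern conclusion (bookkeeping: both checks feed the same doors). -/
theorem forall_det_odd_of_pfRecipeOdd (h : pfRecipeOdd base aux = true) :
    heegnerK base aux = true ∧ ∀ pat : ℕ → ℕ → Bool, (dataK base aux pat).monskyOddS.det = 1 :=
  ⟨(det_dataK_odd_of_pfRecipeOdd base aux h fun _ _ => false).1, fun pat => (det_dataK_odd_of_pfRecipeOdd base aux h pat).2⟩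

/-- The closure recipe check implies the every-pattern conclusion. -/
theorem forall_det_odd_of_pfClosureRecipeOdd (h : pfClosureRecipeOdd base aux = true) :
    heegnerK base aux = true ∧ ∀ pat : ℕ → ℕ → Bool, (dataK base aux pat).monskyOddS.det = 1 :=
  ⟨(det_dataK_odd_of_pfClosureRecipeOdd base aux h fun _ _ => false).1,
    fun pat => (det_dataK_odd_of_pfClosureRecipeOdd base aux h pat).2⟩

/-- Even twins. -/
theorem forall_det_even_of_pfRecipeEven (h : pfRecipeEven base aux = true) :
    heegnerK base aux = true ∧ ∀ pat : ℕ → ℕ → Bool, (dataK base aux pat).monskyEvenS.det = 1 :=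
  ⟨(det_dataK_even_of_pfRecipeEven base aux h fun _ _ => false).1, fun pat => (det_dataK_even_of_pfRecipeEven base aux h pat).2⟩

/-- Even twin of `forall_det_odd_of_pfClosureRecipeOdd`. -/
theorem forall_det_even_of_pfClosureRecipeEven (h : pfClosureRecipeEven base aux = true) :
    heegnerK base aux = true ∧ ∀ pat : ℕ → ℕ → Bool, (dataK base aux pat).monskyEvenS.det = 1 :=
  ⟨(det_dataK_even_of_pfClosureRecipeEven base aux h fun _ _ => false).1,
    fun pat => (det_dataK_even_of_pfClosureRecipeEven base aux h pat).2⟩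

end GeneralKClosure

/-! ## The doors at general `k` from the every-pattern conclusion (so that BOTH checks feed them) -/

section DoorKClosure

open Matrix Literature.NumberTheory.EllipticCurves Literature.NumberTheory.EllipticCurves.HeathBrown1994
  Literature.NumberTheory.EllipticCurves.HeathBrown1994.Families
open Literature.NumberTheory.EllipticCurves.Rank1Residual
open Literature.NumberTheory.EllipticCurves.CongruentNumberMonskySelmer
  (card_selmerGroup_two_eq_four_of_det_even' card_selmerGroup_two_eq_four_of_det_odd')
open Summit.BirchSwinnertonDyer.BirchSwinnertonDyer.Theorems.BiquadraticEisensteinDescentHeegnerTwistCouplingInSupplyCornersThreeFacts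
  (dvd_two_mul_of_prime_dvd_conductorNorm)

variable {k : ℕ} {base : SymbData (k + 1)} {aux : List AuxCell} {P : Fin (k + 1) → ℕ} {q : Fin aux.length → ℕ}

namespace RealisesK

/-- `det M_odd = 1` for the actual primes, from the every-pattern conclusion. -/
theorem det_odd_of_forall (h : RealisesK base aux P q) (hwin : ∀ pat : ℕ → ℕ → Bool, (dataK base aux pat).monskyOddS.det = 1) :
    (monskyMatrixOdd (Fin.append P q)).det = 1 := by
  have hM := h.toMatches (fun i j => if hh : i < aux.length ∧ j < aux.length then
      decide (jacobiSym (q ⟨j, hh.2⟩ : ℤ) (q ⟨i, hh.1⟩) = -1) else false) (fun i j _ => by simp [i.isLt, j.isLt])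
  rw [hM.monskyMatrixOdd_eq]
  exact hwin _

/-- `det M_even = 1` for the actual primes, from the every-pattern conclusion. -/
theorem det_even_of_forall (h : RealisesK base aux P q) (hwin : ∀ pat : ℕ → ℕ → Bool, (dataK base aux pat).monskyEvenS.det = 1) :
    (monskyMatrixEven (Fin.append P q)).det = 1 := by
  have hM := h.toMatches (fun i j => if hh : i < aux.length ∧ j < aux.length then
      decide (jacobiSym (q ⟨j, hh.2⟩ : ℤ) (q ⟨i, hh.1⟩) = -1) else false) (fun i j _ => by simp [i.isLt, j.isLt])
  rw [hM.monskyMatrixEven_eq]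
  exact hwin _

/-- `L(E_{n₀}^{(−q₁⋯q_t)}, 1) ≠ 0` modulo Burungale–Tian, odd base, from the every-pattern conclusion.
[cite: BurungaleTian2026, Thm. 1.1] [cite: HeathBrown1994SelmerCongruentII, Appendix (Monsky), typescript p. 39 L10–L33] -/
theorem L_ne_zero_odd_of_forall (hBT : burungaleTian_analyticRank_eq_zero_of_selmerCorank_eq_zero_of_hasCM)
    (h : RealisesK base aux P q) (hwin : ∀ pat : ℕ → ℕ → Bool, (dataK base aux pat).monskyOddS.det = 1) :
    ((congruentNumberCurve (∏ b, P b)).quadraticTwist ((-((∏ j, q j : ℕ) : ℤ) : ℤ) : ℚ)).entireLFunction 1 ≠ 0 := by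
  rw [quadraticTwist_congruentNumberCurve, Int.natAbs_neg, Int.natAbs_natCast]
  have hsq := h.squarefree_prod
  haveI := isElliptic_congruentNumberCurve hsq.ne_zero
  have hM := h.toMatches (fun i j => if hh : i < aux.length ∧ j < aux.length then
      decide (jacobiSym (q ⟨j, hh.2⟩ : ℤ) (q ⟨i, hh.1⟩) = -1) else false) (fun i j _ => by simp [i.isLt, j.isLt])
  have hsel : Nat.card ((congruentNumberCurve ((∏ b, P b) * ∏ j, q j)).selmerGroup 2) = 4 :=
    card_selmerGroup_two_eq_four_of_det_odd' _ (prod_append P q) hM.prime h.odd_append hM.injective (h.det_odd_of_forall hwin)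
  exact (L_one_ne_zero_congruentNumberCurve_of_card_selmerGroup_two hBT hsq hsel).2

/-- `L(E_{2n₀}^{(−q₁⋯q_t)}, 1) ≠ 0` modulo Burungale–Tian, even base, from the every-pattern conclusion.
[cite: BurungaleTian2026, Thm. 1.1] [cite: HeathBrown1994SelmerCongruentII, Appendix (Monsky), typescript p. 41 L20–L36] -/
theorem L_ne_zero_even_of_forall (hBT : burungaleTian_analyticRank_eq_zero_of_selmerCorank_eq_zero_of_hasCM)
    (h : RealisesK base aux P q) (hwin : ∀ pat : ℕ → ℕ → Bool, (dataK base aux pat).monskyEvenS.det = 1) :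
    ((congruentNumberCurve (2 * ∏ b, P b)).quadraticTwist ((-((∏ j, q j : ℕ) : ℤ) : ℤ) : ℚ)).entireLFunction 1 ≠ 0 := by
  rw [quadraticTwist_congruentNumberCurve, Int.natAbs_neg, Int.natAbs_natCast, mul_assoc]
  have hM := h.toMatches (fun i j => if hh : i < aux.length ∧ j < aux.length then
      decide (jacobiSym (q ⟨j, hh.2⟩ : ℤ) (q ⟨i, hh.1⟩) = -1) else false) (fun i j _ => by simp [i.isLt, j.isLt])
  have hsq : Squarefree (2 * ((∏ b, P b) * ∏ j, q j)) := by
    rw [← prod_append]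
    exact squarefree_two_mul_prod_of_injective _ hM.prime h.odd_append hM.injective
  haveI := isElliptic_congruentNumberCurve hsq.ne_zero
  have hsel : Nat.card ((congruentNumberCurve (2 * ((∏ b, P b) * ∏ j, q j))).selmerGroup 2) = 4 :=
    card_selmerGroup_two_eq_four_of_det_even' _ (by rw [prod_append]) hM.prime h.odd_append hM.injective
      (h.det_even_of_forall hwin)
  exact (L_one_ne_zero_congruentNumberCurve_of_card_selmerGroup_two hBT hsq hsel).2

/-- ★ **THE DOOR at general `k`, odd base `W = E_{P₀ P₁ ⋯ P_k}`, from the every-pattern conclusion** (fed by `pfRecipeOdd` through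
`forall_det_odd_of_pfRecipeOdd` or by `pfClosureRecipeOdd` through `forall_det_odd_of_pfClosureRecipeOdd`): realised primes `q₁ … q_t`
(distinct, in the cells, prescribed symbols against the base, NOTHING asked of `(q_j/q_i)`) with `√(q₁⋯q_t)·log(q₁⋯q_t) < π P₀` give the
conclusion of `HeegnerTwistCouplingInSupply` for `(W, P₀)` modulo Burungale–Tian ONLY.
[cite: BurungaleTian2026, Thm. 1.1] [cite: Oesterle1988Gauss, II §3 Proposition p. 57 (27)] -/
theorem cruxOn_odd_of_BT_of_forall (hBT : burungaleTian_analyticRank_eq_zero_of_selmerCorank_eq_zero_of_hasCM)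
    (hh : heegnerK base aux = true) (hwin : ∀ pat : ℕ → ℕ → Bool, (dataK base aux pat).monskyOddS.det = 1)
    (h : RealisesK base aux P q) {n : ℕ} (hn : ∏ b, P b = n) [(congruentNumberCurve n).IsElliptic]
    (hsize : Real.sqrt ((∏ j, q j : ℕ) : ℝ) * Real.log ((∏ j, q j : ℕ) : ℝ) < Real.pi * P 0) :
    ∃ (K : Type) (_ : Field K) (_ : NumberField K),
      IsImaginaryQuadratic K ∧ 4 < (NumberField.discr K).natAbs ∧
      SatisfiesHeegnerHypothesis ((congruentNumberCurve n).conductorNorm ℤ) K ∧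
      ((congruentNumberCurve n).quadraticTwist (NumberField.discr K : ℚ)).entireLFunction 1 ≠ 0 ∧
      ¬ P 0 ∣ NumberField.classNumber K := by
  subst hn
  have hN : ∀ ℓ : ℕ, ℓ.Prime → ℓ ∣ (congruentNumberCurve (∏ b, P b)).conductorNorm ℤ → ℓ = 2 ∨ ∃ b, ℓ = P b := by
    intro ℓ hℓ hℓN
    have h2 : ℓ ∣ 2 * ∏ b, P b := dvd_two_mul_of_prime_dvd_conductorNorm hℓ hℓN
    rcases (Nat.Prime.dvd_mul hℓ).mp h2 with h2 | hP
    · exact Or.inl ((Nat.prime_dvd_prime_iff_eq hℓ Nat.prime_two).mp h2)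
    · obtain ⟨b, -, hb⟩ := ((Nat.Prime.prime hℓ).dvd_finsetProd_iff _).mp hP
      exact Or.inr ⟨b, (Nat.prime_dvd_prime_iff_eq hℓ (h.base_matches.prime b)).mp hb⟩
  obtain ⟨K, iF, iN, hK, hdK, h4, hH, hcl⟩ := h.exists_heegnerField hh hN hsize
  refine ⟨K, iF, iN, hK, h4, hH, ?_, hcl⟩
  rw [hdK]
  exact h.L_ne_zero_odd_of_forall hBT hwin

/-- ★ **THE DOOR at general `k`, even base `W = E_{2 P₀ P₁ ⋯ P_k}`, from the every-pattern conclusion.**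
[cite: BurungaleTian2026, Thm. 1.1] [cite: Oesterle1988Gauss, II §3 Proposition p. 57 (27)] -/
theorem cruxOn_even_of_BT_of_forall (hBT : burungaleTian_analyticRank_eq_zero_of_selmerCorank_eq_zero_of_hasCM)
    (hh : heegnerK base aux = true) (hwin : ∀ pat : ℕ → ℕ → Bool, (dataK base aux pat).monskyEvenS.det = 1)
    (h : RealisesK base aux P q) {n : ℕ} (hn : ∏ b, P b = n) [(congruentNumberCurve (2 * n)).IsElliptic]
    (hsize : Real.sqrt ((∏ j, q j : ℕ) : ℝ) * Real.log ((∏ j, q j : ℕ) : ℝ) < Real.pi * P 0) :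
    ∃ (K : Type) (_ : Field K) (_ : NumberField K),
      IsImaginaryQuadratic K ∧ 4 < (NumberField.discr K).natAbs ∧
      SatisfiesHeegnerHypothesis ((congruentNumberCurve (2 * n)).conductorNorm ℤ) K ∧
      ((congruentNumberCurve (2 * n)).quadraticTwist (NumberField.discr K : ℚ)).entireLFunction 1 ≠ 0 ∧
      ¬ P 0 ∣ NumberField.classNumber K := by
  subst hn
  have hN : ∀ ℓ : ℕ, ℓ.Prime → ℓ ∣ (congruentNumberCurve (2 * ∏ b, P b)).conductorNorm ℤ → ℓ = 2 ∨ ∃ b, ℓ = P b := by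
    intro ℓ hℓ hℓN
    have h4 : ℓ ∣ 2 * (2 * ∏ b, P b) := dvd_two_mul_of_prime_dvd_conductorNorm hℓ hℓN
    rcases (Nat.Prime.dvd_mul hℓ).mp h4 with h2 | h2
    · exact Or.inl ((Nat.prime_dvd_prime_iff_eq hℓ Nat.prime_two).mp h2)
    · rcases (Nat.Prime.dvd_mul hℓ).mp h2 with h2 | hP
      · exact Or.inl ((Nat.prime_dvd_prime_iff_eq hℓ Nat.prime_two).mp h2)
      · obtain ⟨b, -, hb⟩ := ((Nat.Prime.prime hℓ).dvd_finsetProd_iff _).mp hP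
        exact Or.inr ⟨b, (Nat.prime_dvd_prime_iff_eq hℓ (h.base_matches.prime b)).mp hb⟩
  obtain ⟨K, iF, iN, hK, hdK, h4, hH, hcl⟩ := h.exists_heegnerField hh hN hsize
  refine ⟨K, iF, iN, hK, h4, hH, ?_, hcl⟩
  rw [hdK]
  exact h.L_ne_zero_even_of_forall hBT hwin

/-- ★ **THE DOOR for a CLOSURE recipe, odd base.** -/
theorem cruxOn_odd_of_BT_closure (hBT : burungaleTian_analyticRank_eq_zero_of_selmerCorank_eq_zero_of_hasCM)
    (hpf : pfClosureRecipeOdd base aux = true) (h : RealisesK base aux P q) {n : ℕ} (hn : ∏ b, P b = n)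
    [(congruentNumberCurve n).IsElliptic]
    (hsize : Real.sqrt ((∏ j, q j : ℕ) : ℝ) * Real.log ((∏ j, q j : ℕ) : ℝ) < Real.pi * P 0) :
    ∃ (K : Type) (_ : Field K) (_ : NumberField K),
      IsImaginaryQuadratic K ∧ 4 < (NumberField.discr K).natAbs ∧
      SatisfiesHeegnerHypothesis ((congruentNumberCurve n).conductorNorm ℤ) K ∧
      ((congruentNumberCurve n).quadraticTwist (NumberField.discr K : ℚ)).entireLFunction 1 ≠ 0 ∧
      ¬ P 0 ∣ NumberField.classNumber K :=
  h.cruxOn_odd_of_BT_of_forall hBT (forall_det_odd_of_pfClosureRecipeOdd base aux hpf).1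
    (forall_det_odd_of_pfClosureRecipeOdd base aux hpf).2 hn hsize

/-- ★ **THE DOOR for a CLOSURE recipe, even base.** -/
theorem cruxOn_even_of_BT_closure (hBT : burungaleTian_analyticRank_eq_zero_of_selmerCorank_eq_zero_of_hasCM)
    (hpf : pfClosureRecipeEven base aux = true) (h : RealisesK base aux P q) {n : ℕ} (hn : ∏ b, P b = n)
    [(congruentNumberCurve (2 * n)).IsElliptic]
    (hsize : Real.sqrt ((∏ j, q j : ℕ) : ℝ) * Real.log ((∏ j, q j : ℕ) : ℝ) < Real.pi * P 0) :
    ∃ (K : Type) (_ : Field K) (_ : NumberField K),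
      IsImaginaryQuadratic K ∧ 4 < (NumberField.discr K).natAbs ∧
      SatisfiesHeegnerHypothesis ((congruentNumberCurve (2 * n)).conductorNorm ℤ) K ∧
      ((congruentNumberCurve (2 * n)).quadraticTwist (NumberField.discr K : ℚ)).entireLFunction 1 ≠ 0 ∧
      ¬ P 0 ∣ NumberField.classNumber K :=
  h.cruxOn_even_of_BT_of_forall hBT (forall_det_even_of_pfClosureRecipeEven base aux hpf).1
    (forall_det_even_of_pfClosureRecipeEven base aux hpf).2 hn hsize

end RealisesK

end DoorKClosure

/-! ## Examples: the aligned exceptional class at `k = 3` is certified by ONE closure check (and not by the one-stage check) -/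

section Examples

/-- Base X₀: `p ≡ 3 (8)`, `r = (5, 5, 5) (mod 8)`, all symbols `+1` (the w3 g19/g20 exceptional configuration; odd base `E_{p r₁ r₂ r₃}`). -/
theorem closure_example_X0 :
    pfClosureRecipeOdd (⟨![1, 2, 2, 2], fun _ _ => false⟩ : SymbData 4) [(3, 15), (0, 2), (0, 4), (0, 8)] = true ∧
      pfRecipeOdd (⟨![1, 2, 2, 2], fun _ _ => false⟩ : SymbData 4) [(3, 15), (0, 2), (0, 4), (0, 8)] = false := by
  constructor <;> decide +kernel

/-- Base X₁: `p ≡ 3 (8)`, `r = (5, 5, 5) (mod 8)`, all symbols `−1` (the second exceptional configuration), same cells. -/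
theorem closure_example_X1 :
    pfClosureRecipeOdd (⟨![1, 2, 2, 2], fun _ _ => true⟩ : SymbData 4) [(3, 15), (0, 2), (0, 4), (0, 8)] = true ∧
      pfRecipeOdd (⟨![1, 2, 2, 2], fun _ _ => true⟩ : SymbData 4) [(3, 15), (0, 2), (0, 4), (0, 8)] = false := by
  constructor <;> decide +kernel

/-- Hence, for X₀, `det M_odd = 1` for all `2^6` mutual patterns of the four auxiliary primes, by ONE check. -/
theorem det_X0_all_patterns (pat : ℕ → ℕ → Bool) :
    (dataK (⟨![1, 2, 2, 2], fun _ _ => false⟩ : SymbData 4) [(3, 15), (0, 2), (0, 4), (0, 8)] pat).monskyOddS.det = 1 :=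
  (det_dataK_odd_of_pfClosureRecipeOdd _ _ closure_example_X0.1 pat).2

end Examples

end Summit.BirchSwinnertonDyer.BirchSwinnertonDyer.Theorems.SymbolicMonsky
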